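import Summits.AtomisticToContinuum.FouriersLaw.Theses.TangentFlowDephasing
import Literature.MathematicalPhysics.KineticTheory.LangevinChainKernel
import Literature.MathematicalPhysics.KineticTheory.LangevinChainGibbs

/-!
# Birth skeleton (`Lines/birth.lean`) for crux `ThermodynamicLimit` (stmt-AtomisticToContinuum-0742)

Route `TangentFlowDephasing` (sub-problem `FouriersLaw`; the crux is shared verbatim with
`FourierGreenKubo`, `KineticCorner`, `SelfDephasing`, `CurrentTiltRigidity`, `CurrentTiltQuench`,
`NoHiddenChargesKubo`). The crux, WITNESS FORM: for `P = pinnedChain ω₂ lam β γ` (all four `> 0`), ASSUMING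
weak-NESS uniqueness, for every `T > 0`: IF some DLR Gibbs state with a `μ_T`-preserving Green–Kubo dynamics exists,
THEN there is such a pair `(μ_T, D)` such that along EVERY steady-state family `μ` and for EVERY sequence `Dn` of
fixed-`N` response coefficients (`totalCurrent(μ N (T+δ/2) (T-δ/2))/δ → Dn N` as `δ → 0`, `δ ≠ 0`) one has
`Dn N → κ_GK(T) = D.greenKuboConductivity μ_T T = T⁻² ∫_{t>0} C_T(t)`, `C_T(t) = Σ_x ∫ j_0·(j_x∘φ_t) dμ_T`.

## The line: KUNDU–DHAR–NARAYAN OPEN-CHAIN KUBO FORMULA + BULK LIMIT ON WINDOWS + N-UNIFORM TAIL (three stubs)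

Notation (chain of `N+1` sites `0..N`, `N` bonds): `μ₀ = P.gibbsMeasure (N+1) T` (finite-volume Gibbs state),
`K_u = P.transitionKernel (N+1) T T u⁺` (the CONSTRUCTED equal-temperature Langevin kernels), `J = Σ_k j_k`
(`OscillatorChain.bondCurrent`; the last index carries no bond), and the OPEN-CHAIN CURRENT AUTOCORRELATION
`𝒜_N(u) := ∫ J(z)·(K_u J)(z) dμ₀(z)`.

* `stub_openKubo` — THE FINITE-VOLUME KUBO FORMULA IN CURRENT–CURRENT (KDN) FORM, fixed `N ≥ 1`: under weak-NESS
  uniqueness, along any steady family, `totalCurrent(μ (N+1) (T+δ/2) (T-δ/2))/δ → (1/T²)·(1/N)·∫_{u>0} 𝒜_N(u)` —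
  Kundu–Dhar–Narayan's `G_N = (k_B T² N)⁻¹ ∫₀^∞ ⟨J(0)J(u)⟩` with the OPEN equilibrium dynamics, no `L → ∞`
  (KunduDharNarayan2009 arXiv:0809.4543 p. 3; BonettoLebowitzReyBellet2000 §5.2 (32); ReyBellet2003 Rem. 4.4 (56)).
  PROVABLE NOW from three landed theorems (see the stub's docstring): the cross-form boundary Kubo limit
  `boundaryKubo_proof` (value `N(γ²/T²)∫C_N`), kernel centring `IncoherentBounded.CN_eq_kinCorr`, and the
  current–current identity `IncoherentBounded.integral_totalCorr_totalCurrent` (`∫𝒜_N = γ²N²∫C_N`, `N ≥ 1`):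
  `N(γ²/T²)·(γ²N²)⁻¹∫𝒜_N = (1/T²)(1/N)∫𝒜_N`.
* `stub_bulkWindows` — OPEN = CLOSED ON FINITE TIME WINDOWS (the `o(1)` boundary layers; witness form mirroring the
  crux): if some Gibbs/Green–Kubo pair exists at `T`, there is a Gibbs/Green–Kubo pair `(μ_T, D)` such that for every
  window `S > 0`, `(1/N)∫_{0<u≤S} 𝒜_N(u) → ∫_{0<s≤S} C_T(s)` as `N → ∞`: the per-bond current autocorrelation of the open
  equilibrium chain over a FIXED time window converges to the infinite Hamiltonian chain's (locality of the dynamics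
  over finite times + exponential clustering of the 1-D Gibbs state make the two baths a boundary layer of width
  `o(N)`; the shift-invariant DLR state is unique — `pinnedChain_eq_of_isChainGibbsMeasure_of_isShiftInvariant`).
* `stub_uniformTail` — N-UNIFORM INTEGRABLE TAIL OF THE OPEN-CHAIN CURRENT AUTOCORRELATION PER BOND (the hard core,
  "N-uniform decay of equilibrium current correlations of the Langevin chain", BLR2000 §7): each `𝒜_N` is integrable on
  `(0,∞)` (fixed `N`: exponential mixing, CEHR2018 Thm 2.13) AND `sup_{N≥1} (1/N)|∫_{u>S} 𝒜_N(u)| → 0` as `S → ∞`.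
  This is where the route's thesis (bulk self-dephasing: finite L² phonon lifetime, dephasing-limited transport)
  must deliver; it is stated so that the Becker–Menegaki gap-closing barrier does not bite (no uniform spectral gap
  is asked, only uniform integrability of ONE autocorrelation per unit length, to which the slow diffusive modes
  contribute `O(S^{-1/2})` uniformly in `N`).
* `ThermodynamicLimit_of` — the composition, kernel-checked here (no `sorry`): uniqueness of limits in the Hausdorff
  space `ℝ` along the non-trivial filter `𝓝[≠] 0` identifies `Dn (N+1)` with `(1/T²)(1/N)∫𝒜_N` for `N ≥ 1`
  (stub 1); the abstract Moore–Osgood / `ε/3` interchange `tendsto_integral_Ioi_of_windows` (proved below: split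
  `∫_{u>0} = ∫_{0<u≤S} + ∫_{u>S}`, window term by stub 2, open tail by stub 3, closed tail by `C_T ∈ L¹` from
  `HasGreenKubo`) gives `(1/N)∫𝒜_N → ∫_{t>0} C_T = T²κ_GK`; scaling by `1/T²` and the index shift
  `tendsto_add_atTop_iff_nat 1` give `Dn → D.greenKuboConductivity μ_T T` BY NAME. `ThermodynamicLimit_of_FourierGreenKubo`
  is the same theorem concluding the shared item's primary declaration `FourierGreenKubo.ThermodynamicLimit` (definitionally
  equal `def`, byte-identical signature), so the skeleton serves every route wanting stmt-0742.

Disproof used: no `Cruxes/ThermodynamicLimit/Disproof.lean` exists (`ledger crux ls stmt-AtomisticToContinuum-0742`: no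
workfiles before this one). Honoured load-bearing hypotheses of the crux: weak-NESS uniqueness and the steady family
are consumed by `stub_openKubo` (as in the landed sibling `BoundaryKubo`, whose `Negative.LoadBearing` lemmas show
they cannot be dropped), `T > 0` by all three stubs, the Green–Kubo existence hypothesis by `stub_bulkWindows`.
`ledger negatives --problem AtomisticToContinuum`: no refuted statement concerns fixed-`N` Kubo identities or the
open-chain autocorrelation; the retired `∀ (μ_T, D)` form stmt-0704 is avoided (witness form kept in stub 2).
-/

noncomputable section

open MeasureTheory ProbabilityTheory Filter Topology Set
open scoped NNReal

namespace Summit.AtomisticToContinuum.FouriersLaw.Cruxes.ThermodynamicLimit.Birth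

open Literature.MathematicalPhysics.KineticTheory.HeatConduction
open Summit.AtomisticToContinuum.FouriersLaw.Theses.TangentFlowDephasing (ThermodynamicLimit)

/-! ### The registered stubs (`sorry` lives ONLY here) -/

/-- STUB 1 `stub_openKubo` (size L; PROVABLE NOW from landed theorems) — **the finite-volume Kubo formula of the open
chain in current–current (Kundu–Dhar–Narayan) form.** For `P = pinnedChain ω₂ lam β γ` (all `> 0`), under weak-NESS
uniqueness, along every steady-state family `μ`, for every `T > 0` and `N ≥ 1` (chain of `N+1` sites, `N` bonds):
`totalCurrent(μ (N+1) (T+δ/2) (T-δ/2))/δ → (1/T²)·(1/N)·∫_{u>0} ∫ J·(K_u J) dμ₀` as `δ → 0`, `δ ≠ 0`, where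
`μ₀ = P.gibbsMeasure (N+1) T`, `K_u = P.transitionKernel (N+1) T T u⁺`, `J = Σ_k j_k`. Discharge (three landed
theorems): `(boundaryKubo_proof … huniq μ hμ T hT N).2` (`Theorems/PhononMeanFreePathBoundaryKubo.lean`: the limit
exists and equals `N(γ²/T²)∫_{t>0} Cov_{μ₀}(p_0², K_t p_N²)`), `IncoherentBounded.CN_eq_kinCorr hω hl.le hβ hγ hT N t`
(`…IncoherentBoundedFixedN.lean`: `Cov_{μ₀}(p_0², K_t p_N²) = ∫(p_0²-T)K_t(p_N²-T)dμ₀`) and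
`IncoherentBounded.integral_totalCorr_totalCurrent hω hl.le hβ hγ hT hN` (`…IncoherentBoundedCurrentKubo.lean`:
`∫_{u>0}∫J·K_uJ dμ₀ = γ²N²∫_{u>0}∫(p_0²-T)K_u(p_N²-T)dμ₀`), then `field_simp; ring`.
[cite: KunduDharNarayan2009, arXiv:0809.4543 p. 3] [cite: BonettoLebowitzReyBellet2000, §5.2 eq. (32)]
[cite: ReyBellet2003, Remark 4.4 eq. (56)] -/
theorem stub_openKubo :
    ∀ ω₂ lam β γ : ℝ, 0 < ω₂ → 0 < lam → 0 < β → 0 < γ →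
      (∀ (N : ℕ) (T_L T_R : ℝ), 0 < T_L → 0 < T_R → ∀ μ ν : Measure (PhaseSpace N),
          (pinnedChain ω₂ lam β γ).IsSteadyState N T_L T_R μ →
            (pinnedChain ω₂ lam β γ).IsSteadyState N T_L T_R ν → μ = ν) →
        ∀ μ : (N : ℕ) → ℝ → ℝ → Measure (PhaseSpace N),
          (∀ (N : ℕ) (T_L T_R : ℝ), 0 < T_L → 0 < T_R →
              (pinnedChain ω₂ lam β γ).IsSteadyState N T_L T_R (μ N T_L T_R)) →
            ∀ T : ℝ, 0 < T → ∀ N : ℕ, 1 ≤ N →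
              Tendsto (fun δ : ℝ =>
                  (pinnedChain ω₂ lam β γ).totalCurrent (μ (N + 1) (T + δ / 2) (T - δ / 2)) / δ)
                (𝓝[≠] 0)
                (𝓝 ((1 / T ^ 2) * ((1 / (N : ℝ)) * ∫ u in Ioi (0 : ℝ),
                  ∫ z, (∑ k : Fin (N + 1), (pinnedChain ω₂ lam β γ).bondCurrent (N + 1) k z) *
                      (∫ y, (∑ i : Fin (N + 1), (pinnedChain ω₂ lam β γ).bondCurrent (N + 1) i y)
                        ∂((pinnedChain ω₂ lam β γ).transitionKernel (N + 1) T T u.toNNReal z))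
                    ∂((pinnedChain ω₂ lam β γ).gibbsMeasure (N + 1) T)))) := by
  sorry

/-- STUB 2 `stub_bulkWindows` (size L) — **open = closed on finite time windows (the `o(1)` boundary layers), witness
form.** For `P = pinnedChain ω₂ lam β γ` (all `> 0`) and `T > 0`: if some DLR Gibbs state at `T` carries a
measure-preserving infinite-volume dynamics with Green–Kubo (`HasGreenKubo`), then there is such a pair `(μ_T, D)`
for which, for every window `S > 0`, the per-bond time-integrated current autocorrelation of the OPEN equilibrium
`(N+1)`-chain converges to the infinite Hamiltonian chain's:
`(1/N)·∫_{0<u≤S} ∫ J·(K_u J) dμ₀ → ∫_{0<s≤S} C_T(s)`, `C_T(s) = D.currentCorrelation μ_T s = Σ_x ∫ j_0·(j_x∘φ_s) dμ_T`,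
as `N → ∞`. Content: finite-time locality of the chain dynamics (light cone / `L²`-locality of the flow) and exponential
clustering of the one-dimensional Gibbs state confine the influence of the two Langevin baths and of the free ends to
boundary layers of width `o(N)` over the window; uniqueness of the shift-invariant DLR state
(`pinnedChain_eq_of_isChainGibbsMeasure_of_isShiftInvariant`) and convergence of `μ₀`'s bulk marginals to it identify
the limit. Why it might fail: only through the witness clause (a Green–Kubo pair exists but the physical — shift-invariant,
tempered — pair is not one of them); the window convergence itself is soft. [cite: BonettoLebowitzReyBellet2000, §7 eq. (37)]
[cite: LanfordLebowitzLieb1977, §4 Thm 3] [cite: CuneoEckmannHairerReyBellet2018, Thm 2.13] -/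
theorem stub_bulkWindows :
    ∀ ω₂ lam β γ : ℝ, 0 < ω₂ → 0 < lam → 0 < β → 0 < γ → ∀ T : ℝ, 0 < T →
      (∃ μT : Measure ChainConfig, (pinnedChain ω₂ lam β γ).IsChainGibbsMeasure T μT ∧
          ∃ D : InfiniteChainDynamics (pinnedChain ω₂ lam β γ), D.PreservesMeasure μT ∧ D.HasGreenKubo μT T) →
        ∃ (μT : Measure ChainConfig) (D : InfiniteChainDynamics (pinnedChain ω₂ lam β γ)),
          (pinnedChain ω₂ lam β γ).IsChainGibbsMeasure T μT ∧ D.PreservesMeasure μT ∧ D.HasGreenKubo μT T ∧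
            ∀ S : ℝ, 0 < S →
              Tendsto (fun N : ℕ => (1 / (N : ℝ)) * ∫ u in Ioc (0 : ℝ) S,
                  ∫ z, (∑ k : Fin (N + 1), (pinnedChain ω₂ lam β γ).bondCurrent (N + 1) k z) *
                      (∫ y, (∑ i : Fin (N + 1), (pinnedChain ω₂ lam β γ).bondCurrent (N + 1) i y)
                        ∂((pinnedChain ω₂ lam β γ).transitionKernel (N + 1) T T u.toNNReal z))
                    ∂((pinnedChain ω₂ lam β γ).gibbsMeasure (N + 1) T))
                atTop (𝓝 (∫ s in Ioc (0 : ℝ) S, D.currentCorrelation μT s)) := by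
  sorry

/-- STUB 3 `stub_uniformTail` (size XL; the hard core) — **`N`-uniform integrable tail of the open-chain current
autocorrelation per bond.** For `P = pinnedChain ω₂ lam β γ` (all `> 0`) and `T > 0`: (i) for every `N` the open
equilibrium autocorrelation `u ↦ ∫ J·(K_u J) dμ₀` of the `(N+1)`-chain is integrable on `(0,∞)` (fixed `N`: exponential
convergence to `μ₀` in the `e^{ϑH}`-weighted norm, CEHR 2018 Thm 2.13 (2.5), `J` of exponential class and centred), and
(ii) UNIFORMLY IN `N ≥ 1`: for every `ε > 0` there is `S₀ > 0` with `(1/N)·|∫_{u>S} ∫ J·(K_u J) dμ₀| ≤ ε` for all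
`S ≥ S₀` and all `N ≥ 1` — "no transport channel of the open chain outlives a fixed time by a non-negligible amount per
bond, however long the chain" (BLR 2000 §7: N-uniform decay of the equilibrium current correlations is "the crux of the
matter"). Why it might fail: the open chain's `L²` spectral gap closes with `N` (Becker–Menegaki 2022, barrier
`BeckerMenegaki2022_gapClosing`), so (ii) cannot come from mixing rates; it must come from BULK dephasing (this route:
finite `L²` phonon lifetime) plus a quantitative bound on the weight the slow diffusive energy modes put on `J`
(expected `O(S^{-1/2})` uniformly in `N`); a quasi-conserved odd charge (Mazur) or breather-trapped energy would break it.
[cite: BonettoLebowitzReyBellet2000, §7 after eq. (37)] [cite: CuneoEckmannHairerReyBellet2018, Thm 2.13]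
[cite: BeckerMenegaki2022, Thm 1] -/
theorem stub_uniformTail :
    ∀ ω₂ lam β γ : ℝ, 0 < ω₂ → 0 < lam → 0 < β → 0 < γ → ∀ T : ℝ, 0 < T →
      (∀ N : ℕ, IntegrableOn (fun u : ℝ =>
          ∫ z, (∑ k : Fin (N + 1), (pinnedChain ω₂ lam β γ).bondCurrent (N + 1) k z) *
              (∫ y, (∑ i : Fin (N + 1), (pinnedChain ω₂ lam β γ).bondCurrent (N + 1) i y)
                ∂((pinnedChain ω₂ lam β γ).transitionKernel (N + 1) T T u.toNNReal z))
            ∂((pinnedChain ω₂ lam β γ).gibbsMeasure (N + 1) T)) (Ioi 0)) ∧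
      ∀ ε : ℝ, 0 < ε → ∃ S₀ : ℝ, 0 < S₀ ∧ ∀ S : ℝ, S₀ ≤ S → ∀ N : ℕ, 1 ≤ N →
        |(1 / (N : ℝ)) * ∫ u in Ioi S,
            ∫ z, (∑ k : Fin (N + 1), (pinnedChain ω₂ lam β γ).bondCurrent (N + 1) k z) *
                (∫ y, (∑ i : Fin (N + 1), (pinnedChain ω₂ lam β γ).bondCurrent (N + 1) i y)
                  ∂((pinnedChain ω₂ lam β γ).transitionKernel (N + 1) T T u.toNNReal z))
              ∂((pinnedChain ω₂ lam β γ).gibbsMeasure (N + 1) T)| ≤ ε := by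
  sorry

/-! ### By-name statements of the registered stubs

The skeleton audit (`#h21_check_skeleton`) wants the hypotheses of the crux-concluding theorem to be the declared
stubs BY NAME; `Registered.stub_x` is DEFINITIONALLY the statement of the sorried `theorem stub_x` (`type_of%`), so
`ThermodynamicLimit_of : Registered.stub_openKubo → Registered.stub_bulkWindows → Registered.stub_uniformTail →
ThermodynamicLimit` is literally "stub signatures → crux", and the `example` at the end type-checks
`ThermodynamicLimit_of stub_openKubo stub_bulkWindows stub_uniformTail : ThermodynamicLimit`. -/

namespace Registered

/-- Statement of registered stub 1 (`stub_openKubo`), by name. -/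
def stub_openKubo : Prop := type_of% Birth.stub_openKubo

/-- Statement of registered stub 2 (`stub_bulkWindows`), by name. -/
def stub_bulkWindows : Prop := type_of% Birth.stub_bulkWindows

/-- Statement of registered stub 3 (`stub_uniformTail`), by name. -/
def stub_uniformTail : Prop := type_of% Birth.stub_uniformTail

end Registered

/-! ### The analytic seam (proved): a Moore–Osgood interchange for improper integrals along a sequence -/

/-- **Windows + uniform tail ⇒ convergence of the improper integrals.** If `w N · ∫_{0<u≤S} a_N → ∫_{0<s≤S} c` for
every window `S > 0`, the tails `w N · ∫_{u>S} a_N` are eventually (in `N`) `ε`-small for all `S ≥ S₀(ε)`, each `a_N` is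
integrable on `(0,∞)` and so is `c`, then `w N · ∫_{u>0} a_N → ∫_{s>0} c`. (`ε/3`: split both improper integrals at a
large window `S`; the closed tail is small because `∫_{0..S} c → ∫_{s>0} c`.) [folklore] -/
theorem tendsto_integral_Ioi_of_windows {a : ℕ → ℝ → ℝ} {c : ℝ → ℝ} {w : ℕ → ℝ}
    (hint : ∀ N, IntegrableOn (a N) (Ioi 0))
    (hc : IntegrableOn c (Ioi 0))
    (hwin : ∀ S : ℝ, 0 < S →
      Tendsto (fun N => w N * ∫ u in Ioc 0 S, a N u) atTop (𝓝 (∫ s in Ioc 0 S, c s)))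
    (htail : ∀ ε : ℝ, 0 < ε → ∃ S₀ : ℝ, 0 < S₀ ∧ ∀ S : ℝ, S₀ ≤ S →
      ∀ᶠ N in atTop, |w N * ∫ u in Ioi S, a N u| ≤ ε) :
    Tendsto (fun N => w N * ∫ u in Ioi 0, a N u) atTop (𝓝 (∫ s in Ioi 0, c s)) := by
  rw [Metric.tendsto_atTop]
  intro ε hε
  have hε3 : 0 < ε / 3 := by positivity
  -- the closed tail: windows of `c` converge to the improper integral
  have hcwin : Tendsto (fun S : ℝ => ∫ s in (0 : ℝ)..S, c s) atTop (𝓝 (∫ s in Ioi 0, c s)) :=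
    intervalIntegral_tendsto_integral_Ioi 0 hc tendsto_id
  rw [Metric.tendsto_atTop] at hcwin
  obtain ⟨S₁, hS₁⟩ := hcwin (ε / 3) hε3
  -- the open tail, uniformly (eventually) in `N`
  obtain ⟨S₀, hS₀, hS₀'⟩ := htail (ε / 3) hε3
  set S : ℝ := max S₀ (max S₁ 1) with hSdef
  have hS0 : 0 < S := lt_of_lt_of_le hS₀ (le_max_left _ _)
  have hSS₀ : S₀ ≤ S := le_max_left _ _
  have hSS₁ : S₁ ≤ S := le_trans (le_max_left _ _) (le_max_right _ _)
  -- the window term at this `S`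
  have ha := hwin S hS0
  rw [Metric.tendsto_atTop] at ha
  obtain ⟨N₁, hN₁⟩ := ha (ε / 3) hε3
  obtain ⟨N₂, hN₂⟩ := eventually_atTop.1 (hS₀' S hSS₀)
  refine ⟨max N₁ N₂, fun N hN => ?_⟩
  have hN1 : N₁ ≤ N := le_trans (le_max_left _ _) hN
  have hN2 : N₂ ≤ N := le_trans (le_max_right _ _) hN
  -- split the open improper integral at `S`
  have hunion : Ioc (0 : ℝ) S ∪ Ioi S = Ioi 0 := Ioc_union_Ioi_eq_Ioi hS0.le
  have hsplit : ∫ u in Ioi 0, a N u = (∫ u in Ioc 0 S, a N u) + ∫ u in Ioi S, a N u := by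
    rw [← setIntegral_union Ioc_disjoint_Ioi_same measurableSet_Ioi
      ((hint N).mono_set Ioc_subset_Ioi_self) ((hint N).mono_set (Ioi_subset_Ioi hS0.le)), hunion]
  have hcS : dist (∫ s in (0 : ℝ)..S, c s) (∫ s in Ioi 0, c s) < ε / 3 := hS₁ S hSS₁
  rw [intervalIntegral.integral_of_le hS0.le] at hcS
  have haS : dist (w N * ∫ u in Ioc 0 S, a N u) (∫ s in Ioc 0 S, c s) < ε / 3 := hN₁ N hN1
  have htS : |w N * ∫ u in Ioi S, a N u| ≤ ε / 3 := hN₂ N hN2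
  rw [Real.dist_eq] at hcS haS ⊢
  rw [hsplit, mul_add]
  calc |w N * (∫ u in Ioc 0 S, a N u) + w N * (∫ u in Ioi S, a N u) - ∫ s in Ioi 0, c s|
      = |(w N * (∫ u in Ioc 0 S, a N u) - ∫ s in Ioc 0 S, c s) + w N * (∫ u in Ioi S, a N u) +
          ((∫ s in Ioc 0 S, c s) - ∫ s in Ioi 0, c s)| := by
        congr 1; ring
    _ ≤ |w N * (∫ u in Ioc 0 S, a N u) - ∫ s in Ioc 0 S, c s| + |w N * (∫ u in Ioi S, a N u)| +
          |(∫ s in Ioc 0 S, c s) - ∫ s in Ioi 0, c s| := abs_add_three _ _ _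
    _ < ε / 3 + ε / 3 + ε / 3 := by linarith
    _ = ε := by ring

/-! ### The composition (kernel-checked, no `sorry`): the three stubs give the crux BY NAME -/

/-- `stub_openKubo → stub_bulkWindows → stub_uniformTail → ThermodynamicLimit`. Take the Green–Kubo pair `(μ_T, D)`
of `stub_bulkWindows`; for a steady family `μ` and fixed-`N` response coefficients `Dn`, uniqueness of limits along
`𝓝[≠] 0` and `stub_openKubo` give `Dn (N+1) = (1/T²)·(1/N)·∫_{u>0}𝒜_N` for `N ≥ 1`; `tendsto_integral_Ioi_of_windows`
(windows: stub 2; open tail: stub 3; closed tail: `C_T ∈ L¹` from `HasGreenKubo`) gives `(1/N)∫𝒜_N → ∫_{t>0} C_T`;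
multiply by `1/T²` (`greenKuboConductivity = (T²)⁻¹∫_{t>0}C_T` by definition) and shift the index by one
(`tendsto_add_atTop_iff_nat`). [folklore] -/
theorem ThermodynamicLimit_of (h1 : Registered.stub_openKubo) (h2 : Registered.stub_bulkWindows)
    (h3 : Registered.stub_uniformTail) : ThermodynamicLimit := by
  intro ω₂ lam β γ hω hl hβ hγ huniq T hT hGK
  obtain ⟨μT, D, hG, hP, hK, hwin⟩ := h2 ω₂ lam β γ hω hl hβ hγ T hT hGK
  obtain ⟨hint, htail⟩ := h3 ω₂ lam β γ hω hl hβ hγ T hT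
  refine ⟨μT, D, hG, hP, hK, fun μ hμ Dn hDn => ?_⟩
  -- Step 1 (stub 1): the fixed-`N` response coefficient IS the per-bond open Kubo integral, `N ≥ 1`
  have hfix : ∀ N : ℕ, 1 ≤ N → Dn (N + 1) = (1 / T ^ 2) * ((1 / (N : ℝ)) * ∫ u in Ioi (0 : ℝ),
      ∫ z, (∑ k : Fin (N + 1), (pinnedChain ω₂ lam β γ).bondCurrent (N + 1) k z) *
          (∫ y, (∑ i : Fin (N + 1), (pinnedChain ω₂ lam β γ).bondCurrent (N + 1) i y)
            ∂((pinnedChain ω₂ lam β γ).transitionKernel (N + 1) T T u.toNNReal z))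
        ∂((pinnedChain ω₂ lam β γ).gibbsMeasure (N + 1) T)) := fun N hN =>
    tendsto_nhds_unique (hDn (N + 1)) (h1 ω₂ lam β γ hω hl hβ hγ huniq μ hμ T hT N hN)
  -- Step 2 (stubs 2 + 3 + `C_T ∈ L¹`): the per-bond open Kubo integral converges to the bulk Green–Kubo integral
  have hlim : Tendsto (fun N : ℕ => (1 / (N : ℝ)) * ∫ u in Ioi (0 : ℝ),
      ∫ z, (∑ k : Fin (N + 1), (pinnedChain ω₂ lam β γ).bondCurrent (N + 1) k z) *
          (∫ y, (∑ i : Fin (N + 1), (pinnedChain ω₂ lam β γ).bondCurrent (N + 1) i y)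
            ∂((pinnedChain ω₂ lam β γ).transitionKernel (N + 1) T T u.toNNReal z))
        ∂((pinnedChain ω₂ lam β γ).gibbsMeasure (N + 1) T)) atTop
      (𝓝 (∫ s in Ioi (0 : ℝ), D.currentCorrelation μT s)) :=
    tendsto_integral_Ioi_of_windows
      (a := fun (N : ℕ) (u : ℝ) =>
        ∫ z, (∑ k : Fin (N + 1), (pinnedChain ω₂ lam β γ).bondCurrent (N + 1) k z) *
            (∫ y, (∑ i : Fin (N + 1), (pinnedChain ω₂ lam β γ).bondCurrent (N + 1) i y)
              ∂((pinnedChain ω₂ lam β γ).transitionKernel (N + 1) T T u.toNNReal z))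
          ∂((pinnedChain ω₂ lam β γ).gibbsMeasure (N + 1) T))
      (c := fun s => D.currentCorrelation μT s) (w := fun N : ℕ => 1 / (N : ℝ))
      hint hK.2.1 hwin (fun ε hε => by
        obtain ⟨S₀, hS₀, h⟩ := htail ε hε
        exact ⟨S₀, hS₀, fun S hS => eventually_atTop.2 ⟨1, fun N hN => h S hS N hN⟩⟩)
  -- Step 3: scale by `1/T²` and shift the index
  have hval : (1 / T ^ 2) * ∫ s in Ioi (0 : ℝ), D.currentCorrelation μT s = D.greenKuboConductivity μT T := by
    rw [InfiniteChainDynamics.greenKuboConductivity, one_div]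
  have hlim' : Tendsto (fun N : ℕ => Dn (N + 1)) atTop (𝓝 (D.greenKuboConductivity μT T)) := by
    have h := hlim.const_mul (1 / T ^ 2)
    rw [hval] at h
    refine h.congr' ?_
    filter_upwards [eventually_ge_atTop 1] with N hN
    exact (hfix N hN).symm
  exact (tendsto_add_atTop_iff_nat 1).1 hlim'

/-- **The same skeleton for the shared crux's PRIMARY declaration** `FourierGreenKubo.ThermodynamicLimit` (the ledger
item stmt-AtomisticToContinuum-0742 is wanted, with byte-identical signature, by `FourierGreenKubo` (first), `KineticCorner`,
`CurrentTiltRigidity`, `CurrentTiltQuench`, `NoHiddenChargesKubo` and `TangentFlowDephasing`; the route file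
`TangentFlowDephasing` already imports `Theses.FourierGreenKubo` transitively). The two `def`s are definitionally equal,
so the proof is the previous theorem. [folklore] -/
theorem ThermodynamicLimit_of_FourierGreenKubo (h1 : Registered.stub_openKubo) (h2 : Registered.stub_bulkWindows)
    (h3 : Registered.stub_uniformTail) :
    Summit.AtomisticToContinuum.FouriersLaw.Theses.FourierGreenKubo.ThermodynamicLimit :=
  ThermodynamicLimit_of h1 h2 h3

/-- Type-check (not a declaration): the sorried stubs are literally the antecedents of `ThermodynamicLimit_of`
(conditional on the stubs; an `example`, so it adds nothing to the environment). -/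
example : ThermodynamicLimit := ThermodynamicLimit_of stub_openKubo stub_bulkWindows stub_uniformTail

example : Summit.AtomisticToContinuum.FouriersLaw.Theses.FourierGreenKubo.ThermodynamicLimit :=
  ThermodynamicLimit_of_FourierGreenKubo stub_openKubo stub_bulkWindows stub_uniformTail

end Summit.AtomisticToContinuum.FouriersLaw.Cruxes.ThermodynamicLimit.Birth

end
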